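import Mathlib
import Literature.AlgebraicGeometry.Resolution.ValuationConjugacy
import Literature.AlgebraicGeometry.Resolution.GeneralizedStabilityProofs
import Summits.ResolutionOfSingularities.ResolutionOfSingularities.Theorems.WildQuotientsWildQuotientResolutionValuationInertia
import HarnessLib

/-!
# Automorphisms fixing a CENTRE of a valuation on the integral closure and acting trivially modulo it
# form a p-closed group (crux `WildQuotients.WildQuotientResolution`, stub `stub_phaseZeroHighDim`: (H1) port)

Crux stmt-ResolutionOfSingularities-15640 (`WildQuotientResolution`), registered stub `stub_phaseZeroHighDim`,
residual (H1) = Abbes–Saito 2011 Prop. 2.22 (`…AbbesSaito2011_inertiaNormalSylow_after_admissibleBlowup`).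
The valuation-theoretic endgame of 2.22 (AS Lemma 2.21 through Lemma 2.10; evidence memo
PHASE0-H1-PORTPLAN.md §2b of this hand): along a chain of normalised `U`-admissible models the inertia groups
stabilise to a group of automorphisms which fixes a MAXIMAL IDEAL of the ring `B = ⋂ {W' : W' ∩ K = W ∩ K}`
(the intersection of all extensions to `L` of the valuation ring `W ∩ K`, i.e. the integral closure of
`W ∩ K` in `L`) and acts trivially on `B` modulo that maximal ideal. This file proves that such a group is
p-closed (has a normal Sylow `p`-subgroup, the tree's `HasNormalSylow`), for `L/K` finite and `κ(W)` of
characteristic `p`: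

* `valuation_smul_smul_lt_one_iff` — `|g x|_{gW} < 1 ↔ |x|_W < 1` (transport);
* `smul_eq_of_centre_le` — if `g ∈ Gal(L/K)` maps the centre `𝔪_W ∩ B` into itself then `g • W = W`: the
  extensions of `W ∩ K` are finitely many (fundamental inequality, ✓`FundamentalInequality_holds`) and
  pairwise incomparable (✓`eq_of_le_of_comap_eq`), so their centres on `B` are pairwise incomparable
  (Bourbaki AC VI §7 no. 1 Prop. 2, ✓`interIdeal_le_iff`), while `g` carries the centre of `W` onto the
  centre of `g • W`;
* `valuation_sub_lt_one_of_centre` — if moreover `|g b − b|_W < 1` for all `b ∈ B` then `|g x − x|_W < 1` for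
  all `x ∈ W`: write `x = (zx)/z` with `z, zx ∈ B`, `|z|_W = 1` (Bourbaki's Lemme 1, ✓`exists_inv_taming`);
* `hasNormalSylow_of_centre` — hence such a subgroup lies in the inertia group `G_T(W)` and is p-closed
  (✓`ValuationInertia.hasNormalSylow_of_le_inertiaGroup`, Zariski–Samuel VI §12 Thms 24–25).

[OURS · crux stmt-ResolutionOfSingularities-15640 · helper toward `stub_phaseZeroHighDim` (the terminal
valuation-theoretic step of a Zariski-local port of (H1); NOT a proof of the stub); counted 0; AI-level work,
weaker than expert review.] [cite: AbbesSaito2011, Lemma 2.10, Lemma 2.21] [cite: BourbakiAC5to7, Ch. VI §7 no. 1]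
[cite: ZariskiSamuel1960, Ch. VI §12, Thms 24–25]
-/

-- single-problem summit: the doubled namespace component `ResolutionOfSingularities` is forced
set_option linter.dupNamespace false

noncomputable section

open scoped Pointwise
open Literature.AlgebraicGeometry.Resolution Literature.AlgebraicGeometry.CossartPiltant200819
open Literature.AlgebraicGeometry.Ramification

namespace Summit.ResolutionOfSingularities.ResolutionOfSingularities.Theorems.WildQuotientResolution.CentreInertia

universe u

variable {K L : Type u} [Field K] [Field L] [Algebra K L]

/-- Transport of `|·| < 1` along an automorphism: `|g x|_{g • W} < 1 ↔ |x|_W < 1`. [folklore] -/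
theorem valuation_smul_smul_lt_one_iff (g : L ≃ₐ[K] L) (W : ValuationSubring L) (x : L) :
    (g • W).valuation (g x) < 1 ↔ W.valuation x < 1 := by
  rw [valuation_lt_one_iff_eq_zero_or_inv_not_mem, valuation_lt_one_iff_eq_zero_or_inv_not_mem,
    map_eq_zero_iff g g.injective, ← map_inv₀, show g x⁻¹ = g • x⁻¹ from rfl,
    ValuationSubring.smul_mem_pointwise_smul_iff]

/-- An automorphism over `K` carries an extension of `W ∩ K` to an extension of `W ∩ K`. [folklore] -/
theorem comap_smul_eq (g : L ≃ₐ[K] L) (W : ValuationSubring L) :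
    (g • W).comap (algebraMap K L) = W.comap (algebraMap K L) := by
  ext c
  rw [ValuationSubring.mem_comap, ValuationSubring.mem_comap,
    ValuationSubring.mem_pointwise_smul_iff_inv_smul_mem, show g⁻¹ • algebraMap K L c =
      g⁻¹ (algebraMap K L c) from rfl, AlgEquiv.commutes]

/-- The ring `B = ⋂ {W' : W' ∩ K = W ∩ K}` is stable under `Gal(L/K)`. [folklore] -/
theorem smul_mem_of_forall_mem (g : L ≃ₐ[K] L) (W : ValuationSubring L) {b : L}
    (hb : ∀ W' : ValuationSubring L, W'.comap (algebraMap K L) = W.comap (algebraMap K L) → b ∈ W') :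
    ∀ W' : ValuationSubring L, W'.comap (algebraMap K L) = W.comap (algebraMap K L) → g b ∈ W' := by
  intro W' hW'
  have h := hb (g⁻¹ • W') (by rw [comap_smul_eq, hW'])
  rw [ValuationSubring.mem_pointwise_smul_iff_inv_smul_mem, inv_inv] at h
  exact h

/-- **If `g` maps the centre `𝔪_W ∩ B` into itself then `g • W = W`** (`B` = the intersection of all
extensions of `W ∩ K`; `L/K` finite). The extensions are finitely many and pairwise incomparable, so their
centres on `B` are pairwise incomparable (Bourbaki AC VI §7 no. 1, Prop. 2), and `g` carries the centre of
`W` ONTO the centre of `g • W`. [cite: BourbakiAC5to7, Ch. VI §7 no. 1, Prop. 2] -/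
theorem smul_eq_of_centre_le [FiniteDimensional K L] (W : ValuationSubring L) (g : L ≃ₐ[K] L)
    (hM : ∀ b : L, (∀ W' : ValuationSubring L,
        W'.comap (algebraMap K L) = W.comap (algebraMap K L) → b ∈ W') →
      W.valuation b < 1 → W.valuation (g b) < 1) :
    g • W = W := by
  classical
  obtain ⟨s, hs, -⟩ := FundamentalInequality_holds K L inferInstance (W.comap (algebraMap K L))
  let O : ↥s → ValuationSubring L := fun i => (i : ValuationSubring L)
  have hO : ∀ i j : ↥s, O i ≤ O j → i = j := fun i j hle =>
    Subtype.ext (eq_of_le_of_comap_eq K (O i) (O j) hle (by rw [(hs _).mp i.2, (hs _).mp j.2]))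
  have hWs : W ∈ s := (hs W).mpr rfl
  have hgWs : g • W ∈ s := (hs _).mpr (comap_smul_eq g W)
  -- membership in `B = interRing O`
  have hB : ∀ {b : L}, (∀ W' : ValuationSubring L,
      W'.comap (algebraMap K L) = W.comap (algebraMap K L) → b ∈ W') ↔ b ∈ interRing O := by
    intro b
    rw [mem_interRing]
    exact ⟨fun h i => h _ ((hs _).mp i.2), fun h W' hW' => h ⟨W', (hs W').mpr hW'⟩⟩
  -- the centre of `g • W` lies in the centre of `W`
  have hle : interIdeal O ⟨g • W, hgWs⟩ ≤ interIdeal O ⟨W, hWs⟩ := by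
    intro b hb
    rw [mem_interIdeal] at hb ⊢
    change (g • W).valuation (b : L) < 1 at hb
    change W.valuation (b : L) < 1
    -- `b = g (g⁻¹ b)` with `g⁻¹ b ∈ B` and `|g⁻¹ b|_W < 1`
    have hb' : (∀ W' : ValuationSubring L,
        W'.comap (algebraMap K L) = W.comap (algebraMap K L) → g⁻¹ (b : L) ∈ W') :=
      smul_mem_of_forall_mem g⁻¹ W (hB.mpr b.2)
    have hv : W.valuation (g⁻¹ (b : L)) < 1 := by
      rw [← valuation_smul_smul_lt_one_iff g W]
      change (g • W).valuation ((g * g⁻¹) (b : L)) < 1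
      rwa [mul_inv_cancel, AlgEquiv.one_apply]
    have := hM _ hb' hv
    change W.valuation ((g * g⁻¹) (b : L)) < 1 at this
    rwa [mul_inv_cancel, AlgEquiv.one_apply] at this
  have hij := (interIdeal_le_iff O hO).mp hle
  exact congrArg (fun i : ↥s => (i : ValuationSubring L)) hij

/-- **Residue-triviality extends from `B` to `W`**: if `g • W = W` and `|g b − b|_W < 1` for all `b ∈ B`
then `|g x − x|_W < 1` for all `x ∈ W` (write `x = (zx)/z` with `z, zx ∈ B` and `|z|_W = 1`, Bourbaki's
Lemme 1). [cite: BourbakiAC5to7, Ch. VI §7 no. 1, Lemme 1] -/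
theorem valuation_sub_lt_one_of_centre [FiniteDimensional K L] (W : ValuationSubring L)
    (g : L ≃ₐ[K] L) (hgW : g • W = W)
    (hres : ∀ b : L, (∀ W' : ValuationSubring L,
        W'.comap (algebraMap K L) = W.comap (algebraMap K L) → b ∈ W') →
      W.valuation (g b - b) < 1)
    {x : L} (hx : x ∈ W) : W.valuation (g x - x) < 1 := by
  classical
  obtain ⟨s, hs, -⟩ := FundamentalInequality_holds K L inferInstance (W.comap (algebraMap K L))
  let O : ↥s → ValuationSubring L := fun i => (i : ValuationSubring L)
  have hWs : W ∈ s := (hs W).mpr rfl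
  have hB : ∀ {b : L}, b ∈ interRing O → ∀ W' : ValuationSubring L,
      W'.comap (algebraMap K L) = W.comap (algebraMap K L) → b ∈ W' := by
    intro b h W' hW'
    exact (mem_interRing O).mp h ⟨W', (hs W').mpr hW'⟩
  obtain ⟨z, hzB, hzxB, -, hin, -⟩ := exists_inv_taming O x
  have hz1 : W.valuation z = 1 := hin ⟨W, hWs⟩ hx
  have hz0 : z ≠ 0 := fun h => by rw [h, map_zero] at hz1; exact zero_ne_one hz1
  have hgz1 : W.valuation (g z) = 1 := by
    have hle : W.valuation (g z) ≤ 1 :=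
      (W.valuation_le_one_iff _).mpr (smul_mem_of_forall_mem g W (hB hzB) W rfl)
    refine le_antisymm hle (not_lt.mp fun hlt => ?_)
    have : W.valuation z < 1 := by
      rw [← valuation_smul_smul_lt_one_iff g W, hgW]; exact hlt
    rw [hz1] at this
    exact lt_irrefl _ this
  have hgz0 : g z ≠ 0 := fun h => by rw [h, map_zero] at hgz1; exact zero_ne_one hgz1
  -- `g x − x = (g(zx) − zx + x (z − g z)) / g z`
  have hident : g x - x = (g (z * x) - z * x + x * (z - g z)) / g z := by
    rw [map_mul]; field_simp; ring
  rw [hident, map_div₀, hgz1, div_one]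
  refine Valuation.map_add_lt _ (hres _ (hB hzxB)) ?_
  rw [map_mul]
  calc W.valuation x * W.valuation (z - g z) ≤ 1 * W.valuation (z - g z) := by
        gcongr; exact (W.valuation_le_one_iff x).mpr hx
    _ < 1 := by
        rw [one_mul, ← Valuation.map_neg, neg_sub]
        exact hres _ (hB hzB)

/-- **Automorphisms fixing a centre and acting trivially modulo it form a p-closed group.** Let `L/K` be
finite, `W` a valuation ring of `L` with residue field of characteristic `p`, `B = ⋂ {W' : W' ∩ K = W ∩ K}`
(the intersection of all extensions of `W ∩ K`), and `H ≤ Gal(L/K)` a subgroup whose elements map the centre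
`𝔪_W ∩ B` into itself and satisfy `|g b − b|_W < 1` on `B`. Then `H ≤ G_T(W)` (the inertia group of `W`),
hence `H` has a normal Sylow `p`-subgroup. (The terminal step of the Zariski-local variant of Abbes–Saito's
Lemma 2.21: the limiting inertia along a chain of normalised admissible blow-ups is such an `H`.)
[cite: AbbesSaito2011, Lemma 2.10, Lemma 2.21] [cite: ZariskiSamuel1960, Ch. VI §12, Thms 24–25] -/
theorem hasNormalSylow_of_centre [FiniteDimensional K L] {p : ℕ} [Fact p.Prime] (W : ValuationSubring L)
    [CharP (IsLocalRing.ResidueField W) p] (H : Subgroup (L ≃ₐ[K] L))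
    (hM : ∀ g ∈ H, ∀ b : L, (∀ W' : ValuationSubring L,
        W'.comap (algebraMap K L) = W.comap (algebraMap K L) → b ∈ W') →
      W.valuation b < 1 → W.valuation (g b) < 1)
    (hres : ∀ g ∈ H, ∀ b : L, (∀ W' : ValuationSubring L,
        W'.comap (algebraMap K L) = W.comap (algebraMap K L) → b ∈ W') →
      W.valuation (g b - b) < 1) :
    HasNormalSylow p H := by
  have hle : H ≤ CP2008.inertiaGroup (K := K) W := fun g hg => by
    have hgW : g • W = W := smul_eq_of_centre_le W g (hM g hg)
    exact (CP2008.mem_inertiaGroup_iff' W g).mpr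
      ⟨hgW, fun x hx => valuation_sub_lt_one_of_centre W g hgW (hres g hg) hx⟩
  exact ValuationInertia.hasNormalSylow_of_le_inertiaGroup (K := K) W hle

end Summit.ResolutionOfSingularities.ResolutionOfSingularities.Theorems.WildQuotientResolution.CentreInertia

end
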